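import Literature.AlgebraicTopology.SingularHomology.FiniteCoverTransferProjectionFormula
import HarnessLib

/-!
# Adjointness of the correspondence operator `τ'₁ ∘ p₂^*` for a twisted cup pairing

Two finite coverings `p₁, p₂ : E → B` with the SAME total space (a correspondence `B ← E → B`; the tree's
`IsFiniteCover`, no deck group, no regularity) give the correspondence operator `T = τ'₁ ∘ p₂^*` on `Hᵏ(B; R)`
(`τ'ᵢ` the normalised transfer of `pᵢ`, `τ'ᵢ ∘ pᵢ^* = id`) and its transpose `T' = τ'₂ ∘ p₁^*`.  For a cup
pairing twisted by a class `ℓ ∈ Hˢ(B; R)` and a functional `t_B` on `Hᵗ(B; R)`,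
`Φ(u, v) = t_B((ℓ ⌣ u) ⌣ v)`:

* `IsFiniteCover.isAdjointPair_transferMap_comp_map_smul` — if `p₁^* ℓ = p₂^* ℓ` (the twisting class is
  invariant) and `t_B ∘ τ'₁ = r · t_B ∘ τ'₂` on `Hᵗ(E; R)`, then **`Φ(T u, v) = Φ(u, r • T' v)`**: `T` has the
  RATIONAL adjoint `r • T'` (both sides are `r · t_B(τ'₂((p₂^*ℓ ⌣ p₂^*u) ⌣ p₁^*v))` by the projection formula of
  `FiniteCoverTransferProjectionFormula`);
* `IsFiniteCover.exists_trace_transferMap_eq_mul` — over a field, if `Hᵗ(E; K)` is a line (top cohomology of a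
  connected closed oriented manifold) and `t_B ≠ 0`, the trace hypothesis holds automatically for some `r ≠ 0`
  (two non-zero functionals on a line are proportional; non-vanishing from `τ'ᵢ(pᵢ^* w) = w`); hence
* `IsFiniteCover.exists_isAdjointPair_transferMap_comp_map_smul` — **`∃ r ≠ 0`, `(T, r • T')` is an adjoint
  pair for `Φ`**, with no trace-compatibility hypothesis at all.

With `ℓ = κ` a Kähler class of a smooth projective surface and `t_B` the trace on `H⁴`, `Φ` is the polarisation
form on `H¹` and this is the adjointness input under which a Hodge endomorphism commuting with its adjoint is
semisimple (tree `Motives.HodgeStructurePolarizationNormalSemisimple`) — the classical argument that Hecke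
operators on the cohomology of a compact locally symmetric variety are normal for the Hodge–Riemann (Petersson)
pairing, `ᵗT_γ = T_{γ⁻¹}` (Shimura 1971, (3.4.5)).

Cell pub-hodgecm2, lane «L-BYPASS» (kernel text by the seat pub-hodgecm2-s2crux-idea-2, probe `RA-v22` §3–4, gen 7;
filed by b10).  Theorems only; no named fact.

References: A. Hatcher, *Algebraic Topology* (2002), §3.G p. 321 and Prop. 3G.1, §3.2 Prop. 3.10
[HatcherAT2002]; G. Shimura, *Introduction to the Arithmetic Theory of Automorphic Functions* (1971), §3.4
(3.4.5) (the transpose of a double-coset operator) [Shimura1971].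
-/

noncomputable section

open CategoryTheory

namespace Literature.AlgebraicTopology.SingularHomology.IsFiniteCover

universe u v

variable {E B : Type u} [TopologicalSpace E] [TopologicalSpace B]
variable {R : Type v} [CommRing R] [Algebra ℚ R]

/-! ### The trace ratio of two finite coverings with the same total space -/

section TraceRatio

variable {p₁ p₂ : C(E, B)} (c₁ : IsFiniteCover p₁) (c₂ : IsFiniteCover p₂) {K : Type v} [Field K] [Algebra ℚ K]

/-- `t_B ∘ τ'` does not vanish on `p^* w` when `t_B w ≠ 0` (`τ' ∘ p^* = id`). [cite: HatcherAT2002, §3.G p. 321] -/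
theorem trace_transferMap_map (c : IsFiniteCover p₁) (t : ℕ) (tB : singularCohomology K K B t →ₗ[K] K)
    (w : singularCohomology K K B t) :
    tB (c.transferMap t (singularCohomology.map K K p₁ t w)) = tB w := by
  rw [c.transferMap_map]

/-- **Trace compatibility is free up to a non-zero scalar.**  If `Hᵗ(E; R)` is one-dimensional and
`t_B ≠ 0` on `Hᵗ(B; R)`, then for ANY two finite coverings `p₁, p₂ : E → B` there is `c ≠ 0` with
`t_B (τ'₂ z) = c · t_B (τ'₁ z)` for all `z ∈ Hᵗ(E; R)` (two non-zero functionals on a line are proportional;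
non-vanishing from `τ'ᵢ (pᵢ^* w) = w`). [cite: HatcherAT2002, §3.G p. 321 and Prop. 3G.1] -/
theorem exists_trace_transferMap_eq_mul (t : ℕ)
    (hE : Module.finrank K (singularCohomology K K E t) = 1)
    (tB : singularCohomology K K B t →ₗ[K] K) {w : singularCohomology K K B t} (hw : tB w ≠ 0) :
    ∃ c : K, c ≠ 0 ∧ ∀ z : singularCohomology K K E t,
      tB (c₂.transferMap t z) = c * tB (c₁.transferMap t z) := by
  -- the spanning vector `v := p₁^* w` of the line `Hᵗ(E; R)`
  set v : singularCohomology K K E t := singularCohomology.map K K p₁ t w with hv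
  have hv1 : tB (c₁.transferMap t v) ≠ 0 := by rwa [hv, c₁.transferMap_map]
  have hv0 : v ≠ 0 := by
    intro h
    apply hv1
    rw [h, map_zero, map_zero]
  have hspan : ∀ z : singularCohomology K K E t, ∃ a : K, a • v = z :=
    (finrank_eq_one_iff_of_nonzero' v hv0).1 hE
  -- the second functional does not vanish on `v` either: it does not vanish on `p₂^* w = b • v`
  have hv2 : tB (c₂.transferMap t v) ≠ 0 := by
    obtain ⟨b, hb⟩ := hspan (singularCohomology.map K K p₂ t w)
    have h2 : tB (c₂.transferMap t (singularCohomology.map K K p₂ t w)) ≠ 0 := by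
      rwa [c₂.transferMap_map]
    rw [← hb, map_smul, map_smul, smul_eq_mul] at h2
    exact right_ne_zero_of_mul h2
  refine ⟨tB (c₂.transferMap t v) / tB (c₁.transferMap t v), div_ne_zero hv2 hv1, fun z => ?_⟩
  obtain ⟨a, rfl⟩ := hspan z
  rw [map_smul, map_smul, map_smul, map_smul, smul_eq_mul, smul_eq_mul]
  field_simp

/-- The same, packaged as a pair of trace identities through ONE functional `t_E := t_B ∘ τ'₁` on `Hᵗ(E)`:
`t_B (τ'₁ z) = t_E z` and `t_B (τ'₂ z) = c · t_E z` with `c ≠ 0` (the shape of the trace hypotheses of the tree's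
deck-group version `FiniteDeckTransferAdjointPairing`). [cite: HatcherAT2002, §3.G p. 321 and Prop. 3G.1] -/
theorem exists_traces (t : ℕ) (hE : Module.finrank K (singularCohomology K K E t) = 1)
    (tB : singularCohomology K K B t →ₗ[K] K) {w : singularCohomology K K B t} (hw : tB w ≠ 0) :
    ∃ (c : K) (tE : singularCohomology K K E t →ₗ[K] K), c ≠ 0 ∧
      (∀ z, tB (c₁.transferMap t z) = tE z) ∧ (∀ z, tB (c₂.transferMap t z) = c * tE z) := by
  obtain ⟨c, hc, h⟩ := exists_trace_transferMap_eq_mul c₁ c₂ t hE tB hw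
  exact ⟨c, tB ∘ₗ (c₁.transferMap t).hom, hc, fun z => rfl, fun z => h z⟩


end TraceRatio

/-! ### Adjointness of the Galois-free correspondence operator for a twisted cup pairing -/

section Adjoint

variable {p₁ p₂ : C(E, B)} (c₁ : IsFiniteCover p₁) (c₂ : IsFiniteCover p₂)

/-- **`⟨τ'₁ p₂^* u, v⟩ = r ⟨u, τ'₂ p₁^* v⟩` for `⟨u, v⟩ = t_B((ℓ ⌣ u) ⌣ v)`.**  Hypotheses: the twisting
class is invariant, `p₁^* ℓ = p₂^* ℓ`, and the traces compare, `t_B(τ'₁ z) = r · t_B(τ'₂ z)` on `Hᵗ(E)`.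
Both sides equal `r · t_B(τ'₂((p₂^*ℓ ⌣ p₂^*u) ⌣ p₁^*v))` (twisted projection formula for `c₁`; projection
formula on the left and multiplicativity of `p₂^*` for `c₂`).  Conclusion: `(τ'₁ ∘ p₂^*, r • (τ'₂ ∘ p₁^*))`
is an adjoint pair for `Φ` — the adjoint is a RATIONAL operator whatever `r` is.
[cite: HatcherAT2002, §3.G p. 321 and Prop. 3.10] [cite: Shimura1971, §3.4 (3.4.5)] -/
theorem isAdjointPair_transferMap_comp_map_smul {k m s t : ℕ} (h1 : s + k = m) (h2 : m + k = t)
    (tB : singularCohomology R R B t →ₗ[R] R) (r : R)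
    (htr : ∀ z, tB (c₁.transferMap t z) = r * tB (c₂.transferMap t z))
    (ℓ : singularCohomology R R B s)
    (hℓ : singularCohomology.map R R p₁ s ℓ = singularCohomology.map R R p₂ s ℓ)
    (Φ : singularCohomology R R B k →ₗ[R] singularCohomology R R B k →ₗ[R] R)
    (hΦ : ∀ u v, Φ u v = tB (cupProduct h2 (cupProduct h1 ℓ u) v)) :
    LinearMap.IsAdjointPair Φ Φ
      ((c₁.transferMap k).hom ∘ₗ (singularCohomology.map R R p₂ k).hom)
      (r • ((c₂.transferMap k).hom ∘ₗ (singularCohomology.map R R p₁ k).hom) :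
        singularCohomology R R B k →ₗ[R] singularCohomology R R B k) := by
  intro u v
  have eL : tB (cupProduct h2 (cupProduct h1 ℓ
      ((c₁.transferMap k).hom ((singularCohomology.map R R p₂ k).hom u))) v) =
      tB (c₁.transferMap t (cupProduct h2 (cupProduct h1 (singularCohomology.map R R p₁ s ℓ)
        (singularCohomology.map R R p₂ k u)) (singularCohomology.map R R p₁ k v))) :=
    (congrArg tB (c₁.transferMap_cupProduct_map_cupProduct_map h1 h2 ℓ
      (singularCohomology.map R R p₂ k u) v)).symm
  have eR : tB (cupProduct h2 (cupProduct h1 ℓ u)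
      ((c₂.transferMap k).hom ((singularCohomology.map R R p₁ k).hom v))) =
      tB (c₂.transferMap t (cupProduct h2 (singularCohomology.map R R p₂ m (cupProduct h1 ℓ u))
        (singularCohomology.map R R p₁ k v))) :=
    (congrArg tB (c₂.transferMap_cupProduct_map_left h2 (cupProduct h1 ℓ u)
      (singularCohomology.map R R p₁ k v))).symm
  rw [LinearMap.smul_apply, map_smul, smul_eq_mul, LinearMap.comp_apply, LinearMap.comp_apply, hΦ, hΦ,
    eL, eR, cupProduct_map, htr, hℓ]

/-- **Existence form over a field**: if moreover `Hᵗ(E; K)` is a line (top cohomology of a connected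
closed oriented manifold) and `t_B ≠ 0`, then `τ'₁ ∘ p₂^*` has the adjoint `r • (τ'₂ ∘ p₁^*)` for some
`r ≠ 0` — no trace-compatibility hypothesis at all. [cite: HatcherAT2002, §3.G p. 321 and Prop. 3.10] -/
theorem exists_isAdjointPair_transferMap_comp_map_smul {K : Type v} [Field K] [Algebra ℚ K]
    {k m s t : ℕ} (h1 : s + k = m) (h2 : m + k = t)
    (hE : Module.finrank K (singularCohomology K K E t) = 1)
    (tB : singularCohomology K K B t →ₗ[K] K) {w : singularCohomology K K B t} (hw : tB w ≠ 0)
    (ℓ : singularCohomology K K B s)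
    (hℓ : singularCohomology.map K K p₁ s ℓ = singularCohomology.map K K p₂ s ℓ)
    (Φ : singularCohomology K K B k →ₗ[K] singularCohomology K K B k →ₗ[K] K)
    (hΦ : ∀ u v, Φ u v = tB (cupProduct h2 (cupProduct h1 ℓ u) v)) :
    ∃ r : K, r ≠ 0 ∧ LinearMap.IsAdjointPair Φ Φ
      ((c₁.transferMap k).hom ∘ₗ (singularCohomology.map K K p₂ k).hom)
      (r • ((c₂.transferMap k).hom ∘ₗ (singularCohomology.map K K p₁ k).hom) :
        singularCohomology K K B k →ₗ[K] singularCohomology K K B k) := by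
  obtain ⟨r, hr, htr⟩ := exists_trace_transferMap_eq_mul c₂ c₁ t hE tB hw
  exact ⟨r, hr, c₁.isAdjointPair_transferMap_comp_map_smul c₂ h1 h2 tB r htr ℓ hℓ Φ hΦ⟩

end Adjoint

end Literature.AlgebraicTopology.SingularHomology.IsFiniteCover

end
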